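import Summits.Ventures.CertifiedManyBodySolver.Certificates.HubbardSquare_n7o8_stripeStar_instances
import Summits.Ventures.CertifiedManyBodySolver.Observables.BraggWeightSymmetry
import Summits.Ventures.CertifiedManyBodySolver.Transport.D4VecAction
import HarnessLib
import HarnessLib.Audit

/-!
# Ventures/CertifiedManyBodySolver — Certificates/HubbardSquare_n7o8_stripeStar_arm_instances.lean

HONEST FRAMING: first certified bounds; not a superconductivity verdict; every number certified or labelled float.

**G2 Stage 2, PER-ARM form (lit-1 g10).** The star instances of
`Certificates/HubbardSquare_n7o8_stripeStar_instances.lean` (typer g171: `chargeStar_r262/_r258_instance`,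
`spinStar_r263/_r259_instance`) bound the FOUR-ARM AVERAGE `braggWeight μ star / 4` of a measure `μ` representing the
`D₄`-orbit-mean correlation function (`chargeOrbitCorr ω` / `spinOrbitCorr ω`).  Because that function is an ORBIT MEAN,
it is invariant under the coordinate swap and the two coordinate reflections (`Transport/D4VecAction.lean`:
`d4Sum_comp_swap`, `d4Sum_update_zero_neg`, `d4Sum_update_one_neg` — the swap is `s r³`, the reflections are `s r²` and
`s`), which are exactly the hypotheses `hswap` / `hrefl0` / `hrefl1` of m3-4's `Observables/BraggWeightSymmetry.lean`
(`chargeArm_braggWeight_le_r262/_r258`, `spinArm_braggWeight_le_r263/_r259`: under them the four arms carry EQUAL weight,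
`chargeStar_braggWeight_eq_four_mul`).  Hence, on the same hypotheses as the star instances (the rows' claim nodes + the
torus-limit class binders VERBATIM + a representing `μ`), the SINGLE-ARM Bragg weights obey the same ceilings:
`braggWeight μ ![![π/4, 0]] ≤ 0.0468947` (#262, `t′ = 0`) / `≤ 0.0456555` (#258, `t′ = −1/4`) for the charge-stripe arm
`Q_c = (π/4, 0)`, and `braggWeight μ ![![7π/8, π]] ≤ 0.0873463` (#263) / `≤ 0.0883482` (#259) for the spin-stripe arm
`Q_s = (7π/8, π)`.  By `Observables/BraggWeightWiener.lean` (`tendsto_boxPairMean_re_braggWeight`) each left side is the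
limit `|Λ|⁻² Σ_{x,y∈Λ} e^{-iQ·(x−y)} C(x−y) → braggWeight μ ![Q]` along boxes `Λ = [0,M)²`, the SAME number for every
representing `μ` (`braggWeight_single_eq_of_representing`) — the reading 'squared stripe order parameter per arm'
(m3-4 l.3396; DERIVED, theorem-shaped, conditional on the claim nodes as hypotheses like every instance file; NOT a
CERTIFIED row, no new number).  A CEILING says nothing about the presence of stripe order.  The last section gives the MEASURE-FREE forms (`…_limit`):
for every row state the box structure-factor limit of the orbit-mean correlation at the arm / Néel wave vector EXISTS and
obeys the ceiling (Wiener + Herglotz; no `μ` in the statement).  Zero compute, no sorry.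
-/

noncomputable section

namespace Summit.Ventures.CertifiedManyBodySolver.Certificates

open Literature.MathematicalPhysics.QuantumLattice
open Literature.MathematicalPhysics.QuantumLattice.ThermodynamicLimit
open Literature.Probability.LatticeModels
open Filter Topology HubbardWave0 Literature.MathematicalPhysics.QuantumManyBody.StateRelaxation
open Summit.HubbardSuperconductivity.ManyBodyBootstrap.Bounds
open Summit.Ventures.CertifiedManyBodySolver.SpinStarTL
open Summit.Ventures.CertifiedManyBodySolver.Transport
open MeasureTheory Complex
open scoped Matrix BigOperators Real

variable (ω : InfVolFermionState 2)

/-! ### The orbit means are swap- and reflection-invariant -/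

/-- `chargeOrbitCorr ω` is invariant under the coordinate swap (`s r³ ∈ D₄`). -/
theorem chargeOrbitCorr_comp_swap : ∀ r : Fin 2 → ℤ, chargeOrbitCorr ω (r ∘ Equiv.swap 0 1) = chargeOrbitCorr ω r :=
  fun r => congrArg (fun z : ℂ => (((8 : ℝ)⁻¹ : ℝ) : ℂ) * z)
    (d4Sum_comp_swap (fun v => ω.corr Dc (fermionEmbed (PolySite.shiftEmb v {0}) Dc)) r)

/-- `chargeOrbitCorr ω` is invariant under `x ↦ -x` (`s r² ∈ D₄`). -/
theorem chargeOrbitCorr_update_zero_neg :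
    ∀ r : Fin 2 → ℤ, chargeOrbitCorr ω (Function.update r 0 (-r 0)) = chargeOrbitCorr ω r :=
  fun r => congrArg (fun z : ℂ => (((8 : ℝ)⁻¹ : ℝ) : ℂ) * z)
    (d4Sum_update_zero_neg (fun v => ω.corr Dc (fermionEmbed (PolySite.shiftEmb v {0}) Dc)) r)

/-- `chargeOrbitCorr ω` is invariant under `y ↦ -y` (`s ∈ D₄`). -/
theorem chargeOrbitCorr_update_one_neg :
    ∀ r : Fin 2 → ℤ, chargeOrbitCorr ω (Function.update r 1 (-r 1)) = chargeOrbitCorr ω r :=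
  fun r => congrArg (fun z : ℂ => (((8 : ℝ)⁻¹ : ℝ) : ℂ) * z)
    (d4Sum_update_one_neg (fun v => ω.corr Dc (fermionEmbed (PolySite.shiftEmb v {0}) Dc)) r)

/-- `spinOrbitCorr ω` is invariant under the coordinate swap. -/
theorem spinOrbitCorr_comp_swap : ∀ r : Fin 2 → ℤ, spinOrbitCorr ω (r ∘ Equiv.swap 0 1) = spinOrbitCorr ω r :=
  fun r => congrArg (fun z : ℂ => (((8 : ℝ)⁻¹ : ℝ) : ℂ) * z) (d4Sum_comp_swap (spinCorrSum ω) r)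

/-- `spinOrbitCorr ω` is invariant under `x ↦ -x`. -/
theorem spinOrbitCorr_update_zero_neg :
    ∀ r : Fin 2 → ℤ, spinOrbitCorr ω (Function.update r 0 (-r 0)) = spinOrbitCorr ω r :=
  fun r => congrArg (fun z : ℂ => (((8 : ℝ)⁻¹ : ℝ) : ℂ) * z) (d4Sum_update_zero_neg (spinCorrSum ω) r)

/-- `spinOrbitCorr ω` is invariant under `y ↦ -y`. -/
theorem spinOrbitCorr_update_one_neg :
    ∀ r : Fin 2 → ℤ, spinOrbitCorr ω (Function.update r 1 (-r 1)) = spinOrbitCorr ω r :=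
  fun r => congrArg (fun z : ℂ => (((8 : ℝ)⁻¹ : ℝ) : ℂ) * z) (d4Sum_update_one_neg (spinCorrSum ω) r)

/-! ### Per-arm instances -/

/-- **Row #262, charge-stripe ARM `Q_c = (π/4, 0)`, `t′ = 0`**: for every torus limit `ω` of the row's sector ground
states and every finite measure `μ` representing `chargeOrbitCorr ω`, `braggWeight μ ![![π/4, 0]] ≤ 0.0468947` — GIVEN the
claim nodes of rows #262 and #166 (the hypotheses of `chargeStar_r262_instance` verbatim). -/
theorem chargeArm_r262_instance (hup : cert_r262_lro_M3U8tp0_w2_b4_kry1_kry2c3_hop2_LROCup)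
    (hE : cert_r166_openbox_32x4_U8_N112_tp0_D1000_b2)
    (ω : InfVolFermionState 2) (Ls : ℕ → ℕ) (ψ : ∀ L, Fock (Orb (FermionTorus 2 L)))
    (hLs : Tendsto Ls atTop atTop)
    (hψ : ∀ j, IsGroundStateInSector (hubbardTorusTT' (Ls j) 1 0 8) (rectN (7/8) (Ls j)) 0 (ψ (Ls j)))
    (hψ1 : ∀ j, star (ψ (Ls j)) ⬝ᵥ ψ (Ls j) = 1) (hlim : ω.IsTorusLimitOf ψ Ls)
    (μ : Measure (EuclideanSpace ℝ (Fin 2))) [IsFiniteMeasure μ]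
    (hμ : ∀ r : Fin 2 → ℤ, ∫ ξ, exp ((∑ i, (r i : ℝ) * ξ i : ℝ) * I) ∂μ = chargeOrbitCorr ω r) :
    Observables.braggWeight μ ![![π / 4, 0]] ≤ 0.0468947 := by
  obtain ⟨hω, hn⟩ := m3_rowState_invariances hLs hψ hψ1 hlim
  have hrow := charge_hrow_of hω (m3_lroGc_tp0_r262_uncond_of hup hE ω Ls ψ hLs hψ hψ1 hlim)
  refine Observables.chargeArm_braggWeight_le_r262 μ hμ (chargeOrbitCorr_comp_swap ω)
    (chargeOrbitCorr_update_zero_neg ω) (chargeOrbitCorr_update_one_neg ω) (chargeOrbitCorr_re_zero hω hn)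
    (chargeOrbitCorr_re_e1 hω hn) (chargeOrbitCorr_re_me1 hω hn) (chargeOrbitCorr_re_e2 hω hn)
    (chargeOrbitCorr_re_me2 hω hn) ?_
  refine le_trans hrow (le_of_eq ?_)
  push_cast
  ring

/-- **Row #258, charge-stripe ARM, `t′ = −1/4`**: `braggWeight μ ![![π/4, 0]] ≤ 0.0456555` (claim nodes #258, #149). -/
theorem chargeArm_r258_instance (hup : cert_r258_lro_M3U8tpm1o4_w2_b4_kry1_kry2c3_hop2_LROCup)
    (hE : cert_r149_openbox_16x4_U8_N56_tpm1o4_D1600)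
    (ω : InfVolFermionState 2) (Ls : ℕ → ℕ) (ψ : ∀ L, Fock (Orb (FermionTorus 2 L)))
    (hLs : Tendsto Ls atTop atTop)
    (hψ : ∀ j, IsGroundStateInSector (hubbardTorusTT' (Ls j) 1 (-1/4) 8) (rectN (7/8) (Ls j)) 0 (ψ (Ls j)))
    (hψ1 : ∀ j, star (ψ (Ls j)) ⬝ᵥ ψ (Ls j) = 1) (hlim : ω.IsTorusLimitOf ψ Ls)
    (μ : Measure (EuclideanSpace ℝ (Fin 2))) [IsFiniteMeasure μ]
    (hμ : ∀ r : Fin 2 → ℤ, ∫ ξ, exp ((∑ i, (r i : ℝ) * ξ i : ℝ) * I) ∂μ = chargeOrbitCorr ω r) :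
    Observables.braggWeight μ ![![π / 4, 0]] ≤ 0.0456555 := by
  obtain ⟨hω, hn⟩ := m3_rowState_invariances hLs hψ hψ1 hlim
  have hrow := charge_hrow_of hω (m3_lroGc_tpm1o4_r258_uncond_of hup hE ω Ls ψ hLs hψ hψ1 hlim)
  refine Observables.chargeArm_braggWeight_le_r258 μ hμ (chargeOrbitCorr_comp_swap ω)
    (chargeOrbitCorr_update_zero_neg ω) (chargeOrbitCorr_update_one_neg ω) (chargeOrbitCorr_re_zero hω hn)
    (chargeOrbitCorr_re_e1 hω hn) (chargeOrbitCorr_re_me1 hω hn) (chargeOrbitCorr_re_e2 hω hn)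
    (chargeOrbitCorr_re_me2 hω hn) ?_
  refine le_trans hrow (le_of_eq ?_)
  push_cast
  ring

/-- **Row #263, spin-stripe ARM `Q_s = (7π/8, π)`, `t′ = 0`**: `braggWeight μ ![![7π/8, π]] ≤ 0.0873463` (claim nodes
#263, #92). -/
theorem spinArm_r263_instance (hup : cert_r263_hubSQ_w3_U8_n7o8_R2b4eom_ob5p2_LROSup)
    (hE : cert_r92_luc_ti_upper_tp0_n7o8)
    (ω : InfVolFermionState 2) (Ls : ℕ → ℕ) (ψ : ∀ L, Fock (Orb (FermionTorus 2 L)))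
    (hLs : Tendsto Ls atTop atTop)
    (hψ : ∀ j, IsGroundStateInSector (hubbardTorusTT' (Ls j) 1 0 8) (rectN (7/8) (Ls j)) 0 (ψ (Ls j)))
    (hψ1 : ∀ j, star (ψ (Ls j)) ⬝ᵥ ψ (Ls j) = 1) (hlim : ω.IsTorusLimitOf ψ Ls)
    (μ : Measure (EuclideanSpace ℝ (Fin 2))) [IsFiniteMeasure μ]
    (hμ : ∀ r : Fin 2 → ℤ, ∫ ξ, exp ((∑ i, (r i : ℝ) * ξ i : ℝ) * I) ∂μ = spinOrbitCorr ω r) :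
    Observables.braggWeight μ ![![7 * π / 8, π]] ≤ 0.0873463 := by
  obtain ⟨hω, hn⟩ := m3_rowState_invariances hLs hψ hψ1 hlim
  have hrow := spin_hrow_of hω (m3_lroGs_tp0_r263_uncond_of hup hE ω Ls ψ hLs hψ hψ1 hlim)
  refine Observables.spinArm_braggWeight_le_r263 μ hμ (spinOrbitCorr_comp_swap ω) (spinOrbitCorr_update_zero_neg ω)
    (spinOrbitCorr_update_one_neg ω) (spinOrbitCorr_re_zero hω hn) (spinOrbitCorr_re_e1 hω) (spinOrbitCorr_re_e2 hω)
    (spinOrbitCorr_re_d1 hω) (spinOrbitCorr_re_d2 hω) ?_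
  refine le_trans hrow (le_of_eq ?_)
  push_cast
  ring

/-- **Row #259, spin-stripe ARM, `t′ = −1/4`**: `braggWeight μ ![![7π/8, π]] ≤ 0.0883482` (claim nodes #259, #93). -/
theorem spinArm_r259_instance (hup : cert_r259_hubSQ_w3_U8_n7o8_tpm1o4_R2b4eom_ob5p2_LROSup)
    (hE : cert_r93_luc_ti_upper_tpm1o4_n7o8)
    (ω : InfVolFermionState 2) (Ls : ℕ → ℕ) (ψ : ∀ L, Fock (Orb (FermionTorus 2 L)))
    (hLs : Tendsto Ls atTop atTop)
    (hψ : ∀ j, IsGroundStateInSector (hubbardTorusTT' (Ls j) 1 (-1/4) 8) (rectN (7/8) (Ls j)) 0 (ψ (Ls j)))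
    (hψ1 : ∀ j, star (ψ (Ls j)) ⬝ᵥ ψ (Ls j) = 1) (hlim : ω.IsTorusLimitOf ψ Ls)
    (μ : Measure (EuclideanSpace ℝ (Fin 2))) [IsFiniteMeasure μ]
    (hμ : ∀ r : Fin 2 → ℤ, ∫ ξ, exp ((∑ i, (r i : ℝ) * ξ i : ℝ) * I) ∂μ = spinOrbitCorr ω r) :
    Observables.braggWeight μ ![![7 * π / 8, π]] ≤ 0.0883482 := by
  obtain ⟨hω, hn⟩ := m3_rowState_invariances hLs hψ hψ1 hlim
  have hrow := spin_hrow_of hω (m3_lroGs_tpm1o4_r259_uncond_of hup hE ω Ls ψ hLs hψ hψ1 hlim)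
  refine Observables.spinArm_braggWeight_le_r259 μ hμ (spinOrbitCorr_comp_swap ω) (spinOrbitCorr_update_zero_neg ω)
    (spinOrbitCorr_update_one_neg ω) (spinOrbitCorr_re_zero hω hn) (spinOrbitCorr_re_e1 hω) (spinOrbitCorr_re_e2 hω)
    (spinOrbitCorr_re_d1 hω) (spinOrbitCorr_re_d2 hω) ?_
  refine le_trans hrow (le_of_eq ?_)
  push_cast
  ring

/-! ### Measure-free forms (Wiener): the structure-factor limit itself

By `Observables/BraggWeightWiener.lean`, for ANY finite measure `μ` representing `C`,
`Re (|Λ_M|⁻² Σ_{x,y∈Λ_M} e^{-iQ·(x−y)} C(x−y)) → braggWeight μ ![Q]` along the boxes `Λ_M = [0,M)²`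
(`Observables.boxPairMean`, `tendsto_boxPairMean_re_braggWeight`); and a representing `μ` EXISTS for every row state
(`chargeOrbitCorr_representable` / `spinOrbitCorr_representable`, Herglotz on S2a).  Hence the ceilings can be stated with
NO measure in them: the box structure-factor-per-site² limit of the orbit-mean correlation function exists and obeys the
ceiling.  These are the statements to quote ('squared order parameter at `Q`', DERIVED, conditional on the claim nodes). -/

/-- **Row #262, measure-free**: for every torus limit `ω` of the row's class, the limit
`w = lim_M Re boxPairMean (chargeOrbitCorr ω) (π/4, 0) M` exists and `w ≤ 0.0468947` (claim nodes #262, #166). -/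
theorem chargeArm_r262_limit (hup : cert_r262_lro_M3U8tp0_w2_b4_kry1_kry2c3_hop2_LROCup)
    (hE : cert_r166_openbox_32x4_U8_N112_tp0_D1000_b2)
    (ω : InfVolFermionState 2) (Ls : ℕ → ℕ) (ψ : ∀ L, Fock (Orb (FermionTorus 2 L)))
    (hLs : Tendsto Ls atTop atTop)
    (hψ : ∀ j, IsGroundStateInSector (hubbardTorusTT' (Ls j) 1 0 8) (rectN (7/8) (Ls j)) 0 (ψ (Ls j)))
    (hψ1 : ∀ j, star (ψ (Ls j)) ⬝ᵥ ψ (Ls j) = 1) (hlim : ω.IsTorusLimitOf ψ Ls) :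
    ∃ w : ℝ, Tendsto (fun M => (Observables.boxPairMean (chargeOrbitCorr ω) ![π / 4, 0] M).re) atTop (𝓝 w) ∧
      w ≤ 0.0468947 := by
  obtain ⟨μ, hfin, hμ⟩ := chargeOrbitCorr_representable ω (m3_rowState_invariances hLs hψ hψ1 hlim).1
  haveI := hfin
  exact ⟨_, Observables.tendsto_boxPairMean_re_braggWeight μ hμ ![π / 4, 0],
    chargeArm_r262_instance hup hE ω Ls ψ hLs hψ hψ1 hlim μ hμ⟩

/-- **Row #258, measure-free** (`t′ = −1/4`): the same limit exists and is `≤ 0.0456555` (claim nodes #258, #149). -/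
theorem chargeArm_r258_limit (hup : cert_r258_lro_M3U8tpm1o4_w2_b4_kry1_kry2c3_hop2_LROCup)
    (hE : cert_r149_openbox_16x4_U8_N56_tpm1o4_D1600)
    (ω : InfVolFermionState 2) (Ls : ℕ → ℕ) (ψ : ∀ L, Fock (Orb (FermionTorus 2 L)))
    (hLs : Tendsto Ls atTop atTop)
    (hψ : ∀ j, IsGroundStateInSector (hubbardTorusTT' (Ls j) 1 (-1/4) 8) (rectN (7/8) (Ls j)) 0 (ψ (Ls j)))
    (hψ1 : ∀ j, star (ψ (Ls j)) ⬝ᵥ ψ (Ls j) = 1) (hlim : ω.IsTorusLimitOf ψ Ls) :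
    ∃ w : ℝ, Tendsto (fun M => (Observables.boxPairMean (chargeOrbitCorr ω) ![π / 4, 0] M).re) atTop (𝓝 w) ∧
      w ≤ 0.0456555 := by
  obtain ⟨μ, hfin, hμ⟩ := chargeOrbitCorr_representable ω (m3_rowState_invariances hLs hψ hψ1 hlim).1
  haveI := hfin
  exact ⟨_, Observables.tendsto_boxPairMean_re_braggWeight μ hμ ![π / 4, 0],
    chargeArm_r258_instance hup hE ω Ls ψ hLs hψ hψ1 hlim μ hμ⟩

/-- **Row #263, measure-free (spin arm)**: `w = lim_M Re boxPairMean (spinOrbitCorr ω) (7π/8, π) M` exists and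
`w ≤ 0.0873463` (claim nodes #263, #92). -/
theorem spinArm_r263_limit (hup : cert_r263_hubSQ_w3_U8_n7o8_R2b4eom_ob5p2_LROSup)
    (hE : cert_r92_luc_ti_upper_tp0_n7o8)
    (ω : InfVolFermionState 2) (Ls : ℕ → ℕ) (ψ : ∀ L, Fock (Orb (FermionTorus 2 L)))
    (hLs : Tendsto Ls atTop atTop)
    (hψ : ∀ j, IsGroundStateInSector (hubbardTorusTT' (Ls j) 1 0 8) (rectN (7/8) (Ls j)) 0 (ψ (Ls j)))
    (hψ1 : ∀ j, star (ψ (Ls j)) ⬝ᵥ ψ (Ls j) = 1) (hlim : ω.IsTorusLimitOf ψ Ls) :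
    ∃ w : ℝ, Tendsto (fun M => (Observables.boxPairMean (spinOrbitCorr ω) ![7 * π / 8, π] M).re) atTop (𝓝 w) ∧
      w ≤ 0.0873463 := by
  obtain ⟨μ, hfin, hμ⟩ := spinOrbitCorr_representable ω (m3_rowState_invariances hLs hψ hψ1 hlim).1
  haveI := hfin
  exact ⟨_, Observables.tendsto_boxPairMean_re_braggWeight μ hμ ![7 * π / 8, π],
    spinArm_r263_instance hup hE ω Ls ψ hLs hψ hψ1 hlim μ hμ⟩

/-- **Row #259, measure-free (spin arm, `t′ = −1/4`)**: the same limit exists and is `≤ 0.0883482` (claim nodes #259, #93). -/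
theorem spinArm_r259_limit (hup : cert_r259_hubSQ_w3_U8_n7o8_tpm1o4_R2b4eom_ob5p2_LROSup)
    (hE : cert_r93_luc_ti_upper_tpm1o4_n7o8)
    (ω : InfVolFermionState 2) (Ls : ℕ → ℕ) (ψ : ∀ L, Fock (Orb (FermionTorus 2 L)))
    (hLs : Tendsto Ls atTop atTop)
    (hψ : ∀ j, IsGroundStateInSector (hubbardTorusTT' (Ls j) 1 (-1/4) 8) (rectN (7/8) (Ls j)) 0 (ψ (Ls j)))
    (hψ1 : ∀ j, star (ψ (Ls j)) ⬝ᵥ ψ (Ls j) = 1) (hlim : ω.IsTorusLimitOf ψ Ls) :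
    ∃ w : ℝ, Tendsto (fun M => (Observables.boxPairMean (spinOrbitCorr ω) ![7 * π / 8, π] M).re) atTop (𝓝 w) ∧
      w ≤ 0.0883482 := by
  obtain ⟨μ, hfin, hμ⟩ := spinOrbitCorr_representable ω (m3_rowState_invariances hLs hψ hψ1 hlim).1
  haveI := hfin
  exact ⟨_, Observables.tendsto_boxPairMean_re_braggWeight μ hμ ![7 * π / 8, π],
    spinArm_r259_instance hup hE ω Ls ψ hLs hψ hψ1 hlim μ hμ⟩

/-- **Row #263, measure-free Néel form**: `w = lim_M Re boxPairMean (spinOrbitCorr ω) (π, π) M` exists and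
`w ≤ 0.3360872` (claim nodes #263, #92; via typer's `neel_r263_instance`). -/
theorem neel_r263_limit (hup : cert_r263_hubSQ_w3_U8_n7o8_R2b4eom_ob5p2_LROSup)
    (hE : cert_r92_luc_ti_upper_tp0_n7o8)
    (ω : InfVolFermionState 2) (Ls : ℕ → ℕ) (ψ : ∀ L, Fock (Orb (FermionTorus 2 L)))
    (hLs : Tendsto Ls atTop atTop)
    (hψ : ∀ j, IsGroundStateInSector (hubbardTorusTT' (Ls j) 1 0 8) (rectN (7/8) (Ls j)) 0 (ψ (Ls j)))
    (hψ1 : ∀ j, star (ψ (Ls j)) ⬝ᵥ ψ (Ls j) = 1) (hlim : ω.IsTorusLimitOf ψ Ls) :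
    ∃ w : ℝ, Tendsto (fun M => (Observables.boxPairMean (spinOrbitCorr ω) ![π, π] M).re) atTop (𝓝 w) ∧
      w ≤ 0.3360872 := by
  obtain ⟨μ, hfin, hμ⟩ := spinOrbitCorr_representable ω (m3_rowState_invariances hLs hψ hψ1 hlim).1
  haveI := hfin
  exact ⟨_, Observables.tendsto_boxPairMean_re_braggWeight μ hμ ![π, π],
    neel_r263_instance hup hE ω Ls ψ hLs hψ hψ1 hlim μ hμ⟩

/-- **Row #259, measure-free Néel form (`t′ = −1/4`)**: the same limit exists and is `≤ 0.3399425`. -/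
theorem neel_r259_limit (hup : cert_r259_hubSQ_w3_U8_n7o8_tpm1o4_R2b4eom_ob5p2_LROSup)
    (hE : cert_r93_luc_ti_upper_tpm1o4_n7o8)
    (ω : InfVolFermionState 2) (Ls : ℕ → ℕ) (ψ : ∀ L, Fock (Orb (FermionTorus 2 L)))
    (hLs : Tendsto Ls atTop atTop)
    (hψ : ∀ j, IsGroundStateInSector (hubbardTorusTT' (Ls j) 1 (-1/4) 8) (rectN (7/8) (Ls j)) 0 (ψ (Ls j)))
    (hψ1 : ∀ j, star (ψ (Ls j)) ⬝ᵥ ψ (Ls j) = 1) (hlim : ω.IsTorusLimitOf ψ Ls) :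
    ∃ w : ℝ, Tendsto (fun M => (Observables.boxPairMean (spinOrbitCorr ω) ![π, π] M).re) atTop (𝓝 w) ∧
      w ≤ 0.3399425 := by
  obtain ⟨μ, hfin, hμ⟩ := spinOrbitCorr_representable ω (m3_rowState_invariances hLs hψ hψ1 hlim).1
  haveI := hfin
  exact ⟨_, Observables.tendsto_boxPairMean_re_braggWeight μ hμ ![π, π],
    neel_r259_instance hup hE ω Ls ψ hLs hψ hψ1 hlim μ hμ⟩

end Summit.Ventures.CertifiedManyBodySolver.Certificates

end
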